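import Mathlib
import Summits.Ventures.PercRepro2.A3InactiveTyped
/-!
# The `a₃`-inactive class of row 2′TRI on typed instances: inactivity only where it is needed
(blind cell PercRepro2, p5 g0, 2026-08-25; companion of `A3InactiveTyped.lean`, sub-claim S4 / S1's `NR`)

`A3InactiveTyped.typedCount_nonneg_of_a3_inactive` asks `a₃` to be inactive on EVERY configuration.
A typed instance only ever evaluates the kernel on configurations agreeing with the pinning `z` off
the typed set `F`; on the residual class `NR` (`z ≡ false`) these are the configurations whose open
edges lie in `F`. So the right hypothesis is inactivity on the ADMISSIBLE configurations, and for
`NR` it reduces to «no typed edge at `a₃`, `a₃` distinct from the roots».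

* `typedCount_congr_admissible`: the typed count only sees the kernel on admissible triples;
* `K3_eq_of_inactive_at`: the kernel collapse at a triple of configurations on which `a₃` is inactive;
* **`typedCount_nonneg_of_a3_inactive'`**: row 2′TRI with `a₃` inactive on the admissible
  configurations, conditionally on `TB14`;
* **`typedCount_nonneg_of_a3_typedDeg_zero`**: the `NR` form — `z ≡ false`, no edge of `F` at `a₃`,
  `a₃ ≠ a₁, a₂` — conditionally on `TB14` (the hypothesis p2's conditional `ResidualCon2` variant
  discharges by `typedDeg a₃ = 0`).
-/

namespace Summit.Ventures.PercRepro2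

namespace A3InactiveTyped

open CovForm

section Admissible

variable {V : Type*} {E : Type*} [Fintype E] [DecidableEq E] {R : Type*} [CommRing R]

/-- The typed count only depends on the kernel's values on admissible triples (each copy agreeing
with `z` off `F`). -/
lemma typedCount_congr_admissible (F : Finset E) (z : Config E) (τ : E → ℕ)
    (K K' : Config E → Config E → Config E → R)
    (h : ∀ x y w : Config E, (∀ e, e ∉ F → x e = z e) → (∀ e, e ∉ F → y e = z e) →
      (∀ e, e ∉ F → w e = z e) → K x y w = K' x y w) :
    typedCount F z τ K = typedCount F z τ K' := by
  unfold typedCount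
  refine Finset.sum_congr rfl fun x _ => Finset.sum_congr rfl fun y _ =>
    Finset.sum_congr rfl fun w _ => ?_
  by_cases hc : (∀ e, e ∉ F → x e = z e ∧ y e = z e ∧ w e = z e) ∧ (∀ e ∈ F, openCount x y w e = τ e)
  · rw [if_pos hc, if_pos hc]
    exact h x y w (fun e he => (hc.1 e he).1) (fun e he => (hc.1 e he).2.1)
      (fun e he => (hc.1 e he).2.2)
  · rw [if_neg hc, if_neg hc]

end Admissible

section CollapseAt

variable {V : Type*} {E : Type*} {R : Type*} [Field R]
variable {ends : E → Sym2 V} {a₁ a₂ a₃ : V}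

omit [Field R] in
/-- `PD` and `Q` agree at a configuration on which `a₃` is inactive. -/
lemma mem_PDEvent_iff_of_inactive_at {ω : Config E} (h : ¬ Conn ends ω a₁ a₃ ∧ ¬ Conn ends ω a₂ a₃) :
    ω ∈ PDEvent ends a₁ a₂ a₃ ↔ ω ∈ avoidAll ends a₂ {a₁} := by
  simp only [PDEvent, Dtilde, Set.mem_inter_iff, Set.mem_compl_iff, mem_connEvent, mem_avoidAll,
    Finset.mem_singleton, forall_eq]
  constructor
  · rintro ⟨h12, _⟩
    exact fun h21 => h12 (conn_symm h21)
  · intro h21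
    refine ⟨fun h12 => h21 (conn_symm h12), ?_⟩
    rintro (h31 | h32)
    · exact h.1 (conn_symm h31)
    · exact h.2 (conn_symm h32)

/-- `1_PD ω = 1_Q ω` at a configuration on which `a₃` is inactive. -/
lemma iPD_apply_eq_iQ {ω : Config E} (h : ¬ Conn ends ω a₁ a₃ ∧ ¬ Conn ends ω a₂ a₃) :
    (iPD ends a₁ a₂ a₃ ω : R) = iQ ends a₁ a₂ ω := by
  unfold iPD iQ
  by_cases hω : ω ∈ avoidAll ends a₂ {a₁}
  · rw [Set.indicator_of_mem hω, Set.indicator_of_mem ((mem_PDEvent_iff_of_inactive_at h).2 hω)]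
  · rw [Set.indicator_of_notMem hω,
      Set.indicator_of_notMem (fun h' => hω ((mem_PDEvent_iff_of_inactive_at h).1 h'))]

/-- `1_{a₃ ∈ C₁} ω = 0` when `a₁ ↮ a₃` in `ω`. -/
lemma iL_a3_apply_eq_zero {ω : Config E} (h : ¬ Conn ends ω a₁ a₃) :
    (iL ends a₁ a₃ ω : R) = 0 := by
  unfold iL
  rw [Set.indicator_of_notMem (by rw [mem_connEvent]; exact h)]

/-- `1_{a₃ ∈ C₂} ω = 0` when `a₂ ↮ a₃` in `ω`. -/
lemma iH_a3_apply_eq_zero {ω : Config E} (h : ¬ Conn ends ω a₂ a₃) :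
    (iH ends a₂ a₃ ω : R) = 0 := by
  unfold iH
  rw [Set.indicator_of_notMem (by rw [mem_connEvent]; exact h)]

/-- **The kernel collapse at a triple** on which `a₃` is inactive: `K₃ x y w = 1_Q(x) · psi y w`. -/
theorem K3_eq_of_inactive_at (o b : V) {x y w : Config E}
    (hx : ¬ Conn ends x a₁ a₃ ∧ ¬ Conn ends x a₂ a₃)
    (hy : ¬ Conn ends y a₁ a₃ ∧ ¬ Conn ends y a₂ a₃)
    (hw : ¬ Conn ends w a₁ a₃ ∧ ¬ Conn ends w a₂ a₃) :
    (K3 ends o a₁ a₂ a₃ b x y w : R) = iQ ends a₁ a₂ x * psi ends o a₁ a₂ b y w := by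
  unfold K3 sepKernel
  simp only [Fin.sum_univ_succ, Fin.sum_univ_zero, Matrix.cons_val_zero, Matrix.cons_val_succ,
    add_zero]
  simp only [f3, f4, f5, f6, f7, f10, f11, f12, psi, sigma, inU, iPD_apply_eq_iQ hx,
    iPD_apply_eq_iQ hy, iPD_apply_eq_iQ hw, iL_a3_apply_eq_zero hw.1, iH_a3_apply_eq_zero hw.2]
  ring

end CollapseAt

section MainNR

variable {V : Type} {E : Type} [Fintype E] [DecidableEq E] {R : Type*} [Field R] [LinearOrder R]
  [IsStrictOrderedRing R]

/-- **Row 2′TRI on the `a₃`-inactive class, admissible form** (conditional on `TB14`): `a₃` is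
required to be inactive only on the configurations agreeing with the pinning `z` off `F`. -/
theorem typedCount_nonneg_of_a3_inactive' (h : TB14 R) [Fintype V] [DecidableEq V]
    (ends : E → Sym2 V) (o a₁ a₂ a₃ b : V) (F : Finset E) (z : Config E)
    (hin : ∀ ω : Config E, (∀ e, e ∉ F → ω e = z e) →
      ¬ Conn ends ω a₁ a₃ ∧ ¬ Conn ends ω a₂ a₃)
    (τ : E → ℕ) (hτ : ∀ e ∈ F, τ e = 1 ∨ τ e = 2) :
    0 ≤ typedCount F z τ (K3 ends o a₁ a₂ a₃ b : Config E → Config E → Config E → R) := by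
  rw [typedCount_congr_admissible F z τ _ (fun x y w => iQ ends a₁ a₂ x * psi ends o a₁ a₂ b y w)
    (fun x y w hx hy hw => K3_eq_of_inactive_at o b (hin x hx) (hin y hy) (hin w hw)),
    typedCount_spectator F z τ hτ]
  refine Finset.sum_nonneg fun x _ => ?_
  split_ifs
  · refine mul_nonneg (iQ_nonneg ends a₁ a₂ x) ?_
    rw [pairCount_psi]
    have h1 := h V E ends a₁ a₂ b o (freeAt F τ x) (pinAt F z τ x)
    have h2 := h V E ends a₁ a₂ o b (freeAt F τ x) (pinAt F z τ x)
    exact mul_nonneg (by norm_num) (add_nonneg (sub_nonneg.2 h1) (sub_nonneg.2 h2))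
  · exact le_rfl

omit [Fintype E] [DecidableEq E] [LinearOrder R] [IsStrictOrderedRing R] in
/-- A vertex with no OPEN incident edge is connected to nothing else. -/
lemma eq_of_conn_of_no_open_edge {ends : E → Sym2 V} {ω : Config E} {u v : V}
    (hv : ∀ e, ω e = true → v ∉ ends e) (h : Conn ends ω u v) : u = v := by
  have key : u ∈ ({v} : Set V) := by
    refine mem_of_conn_of_closed (ends := ends) (ω := ω) ?_ (Set.mem_singleton v) (conn_symm h)
    intro x hx y hxy
    rw [Set.mem_singleton_iff] at hx
    subst hx
    obtain ⟨_, e, hopen, hends⟩ := openGraph_adj.1 hxy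
    exact absurd (show x ∈ ends e by rw [hends]; exact Sym2.mem_mk_left x y) (hv e hopen)
  exact Set.mem_singleton_iff.1 key

/-- **The `NR` form** (conditional on `TB14`): with every edge off `F` pinned closed (`z ≡ false`),
no edge of `F` at `a₃`, and `a₃` distinct from the roots, row 2′TRI holds for every type vector
with values in `{1, 2}` on `F` — the hypothesis «`a₃` of typed degree `0`» of sub-claim S1's
residual vocabulary. -/
theorem typedCount_nonneg_of_a3_typedDeg_zero (h : TB14 R) [Fintype V] [DecidableEq V]
    (ends : E → Sym2 V) (o a₁ a₂ a₃ b : V) (F : Finset E) (h3 : ∀ e ∈ F, a₃ ∉ ends e)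
    (h13 : a₁ ≠ a₃) (h23 : a₂ ≠ a₃) (τ : E → ℕ) (hτ : ∀ e ∈ F, τ e = 1 ∨ τ e = 2) :
    0 ≤ typedCount F (fun _ => false) τ
      (K3 ends o a₁ a₂ a₃ b : Config E → Config E → Config E → R) := by
  refine typedCount_nonneg_of_a3_inactive' h ends o a₁ a₂ a₃ b F (fun _ => false) ?_ τ hτ
  intro ω hω
  have hno : ∀ e, ω e = true → a₃ ∉ ends e := by
    intro e he
    by_cases heF : e ∈ F
    · exact h3 e heF
    · exact absurd (he.symm.trans (hω e heF)) (by decide)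
  exact ⟨fun hc => h13 (eq_of_conn_of_no_open_edge hno hc),
    fun hc => h23 (eq_of_conn_of_no_open_edge hno hc)⟩

end MainNR

end A3InactiveTyped

end Summit.Ventures.PercRepro2
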